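import Summits.BirchSwinnertonDyer.BirchSwinnertonDyer.Theorems.EdixhovenFibreFiveSevenStarredOptimalManinUnitFiveSevenKatoUnitChoice
import HarnessLib

/-!
# F″ programme, the UNIT CHOICE for Kato's Thm. 6.6 (1) (`SL₂(ℤ)`-type factor), part 2: Dirichlet characters,
# the CRT choice of `c`, and the socket `[divide T·u·n_ξ]` (route `EdixhovenFibreFiveSeven`, crux K★
# `StarredOptimalManinUnitFiveSeven`, stmt-BirchSwinnertonDyer-22226, line `kato-lever`; `--supports` 22226, helper)

Cell `pub/bsd-wall`, seat `bsd-line-edix-p4` g3 (WIDTH-5 attach). TOOL theorems only (no definition, no named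
fact, no `sorry`); nothing is closed or booked; BSD is not proved by any of this. Continues
`…KatoUnitChoice.lean` (part 1: the currency "`∃ s : ℕ, p ∤ s, IsIntegral ℤ (s·x)`", the cyclotomic unit
`c − μ` at `p`, Kato's factor `c² − cμ`); see its module docstring for the programme context (F″ docstring
item 4 "(Units)"; `Lines/kato-lever-F2-programme.md` §4; P4-core p598912, value exit p598918).

WHAT IS PROVED (all `p` prime).
* §4 Dirichlet characters: `pow_orderOf_apply_eq_one` (`χ(u)^{ord χ} = 1` on units; `ord χ ≠ 0` follows from
  F″'s `p ∤ ord χ`), `inv_pow_orderOf_apply_eq_one`, and the `χ`, `χ⁻¹` specialisations of Kato's factor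
  `exists_isIntegral_mul_inv_katoFactor_dirichlet{,_inv}` (`c² − cχ^{±1}(c) ≠ 0` with `p`-integral inverse
  when `c` is a unit mod `m`, `χ(c) ≠ 1`, `p ∣ c − 1`, `p ∤ ord χ`).
* §5 the CRT choice: `exists_modEq_coprime_six_mul` and ★ `exists_unitChoice`: `χ ≠ 1` mod `m`,
  `gcd(m, M) = 1`, `M ≠ 0` ⟹ `∃ c > 1`, `c ≡ 1 (mod M)`, `gcd(c, 6mM) = 1`, `c` a unit mod `m`, `χ(c) ≠ 1`
  (`m` even or `3 ∣ m` allowed); packaged for F″'s binders (`m.Coprime (p * N)`, `χ ≠ 1`, `p ∤ orderOf χ`) as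
  ★ `exists_unitChoice_kato`: `c ≡ 1 (mod N)`, `c ≡ 1 (mod p)` (also `p ∣ c − 1` in `ℤ`), `gcd(c, 6mpN) = 1`
  (Kato's `(c, 6pmN) = 1` of (8.1.2)/Ex. 13.3 and `c ≡ 1 mod N` of Thm. 6.6 (1)), and BOTH `c² − cχ(c)`,
  `c² − cχ⁻¹(c)` non-zero with `p`-integral inverse.
* §6 the socket: ★ `exists_isIntegral_of_valueLaw` — if `y` is `p`-integral and `y = T · w · L` with `T ≠ 0`
  of `p`-integral inverse, `w ∈ ℚ`, `p ∤ num w`, then `L` is `p`-integral (`y` = P4-core's character sum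
  `Σ_b χ(b)σ_b(exp* z)`, `L` = the value exit's `hint` quantity `L_{pN}(f, χ̄, 1)/Ω^±`); and
  `exists_unitChoice_divide` (the choice made: `d = c`, `T = (c² − cχ⁻¹(c))(d² − dχ⁻¹(d))`, for EVERY value law
  `y = T·w·L`).

References: [Kato2004Asterisque] K. Kato, Astérisque 295 (2004), Thm. 6.6 (1) p. 163, (4.2.4) p. 143, (8.1.2)
p. 180, Ex. 13.3 p. 225, Thm. 13.6 p. 227; F″'s docstring item 4/(a) ("Choose `c ≡ d ≡ 1 (mod pN)`,
`(cd, 6) = 1`, with `χ(c)`, `χ(d)` [non-trivial] (CRT)"); the CRT and the character bookkeeping are [folklore].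
-/

set_option autoImplicit false
-- the Theorems namespace of a single-conjunct summit repeats the summit name by design (D-0017)
set_option linter.dupNamespace false

noncomputable section

open scoped BigOperators
open Finset

namespace Summit.BirchSwinnertonDyer.BirchSwinnertonDyer.Theorems.KatoUnitChoice

variable {p : ℕ} [Fact p.Prime]


/-! ## §4 Dirichlet characters: the values `χ(c)`, `χ⁻¹(c)` are roots of unity of order `∣ ord χ` -/

/-- For a Dirichlet character `χ` of finite order (`ord χ ≠ 0`) and a unit `u`: `χ(u)^{ord χ} = 1`.
[folklore] -/
theorem pow_orderOf_apply_eq_one {m : ℕ} (χ : DirichletCharacter ℂ m) (hχ : orderOf χ ≠ 0)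
    (u : (ZMod m)ˣ) : χ (u : ZMod m) ^ orderOf χ = 1 := by
  rw [← MulChar.pow_apply' χ hχ, pow_orderOf_eq_one, MulChar.one_apply_coe]

/-- Same for `χ⁻¹`: `χ⁻¹(u)^{ord χ} = 1` and `χ⁻¹(u) ≠ 1 ↔ χ(u) ≠ 1` (`χ⁻¹(u) = χ(u)⁻¹`). [folklore] -/
theorem inv_pow_orderOf_apply_eq_one {m : ℕ} (χ : DirichletCharacter ℂ m) (hχ : orderOf χ ≠ 0)
    (u : (ZMod m)ˣ) : χ⁻¹ (u : ZMod m) ^ orderOf χ = 1 ∧ (χ⁻¹ (u : ZMod m) ≠ 1 ↔ χ (u : ZMod m) ≠ 1) := by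
  rw [MulChar.inv_apply_eq_inv']
  refine ⟨by rw [inv_pow, pow_orderOf_apply_eq_one χ hχ u, inv_one], ?_⟩
  exact not_congr inv_eq_one

/-- Kato's factor with `μ = χ(c)`: for `χ` mod `m` with `p ∤ ord χ`, `c ∈ ℕ` a unit mod `m` with
`χ(c) ≠ 1` and `p ∣ c − 1`: `c² − c·χ(c) ≠ 0` and its inverse is `p`-integral.
[cite: Kato2004Asterisque, Thm. 6.6 (1) p. 163] -/
theorem exists_isIntegral_mul_inv_katoFactor_dirichlet {m : ℕ} (χ : DirichletCharacter ℂ m)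
    (hord : ¬ p ∣ orderOf χ) {c : ℕ} (hcu : IsUnit (c : ZMod m)) (hχc : χ (c : ZMod m) ≠ 1)
    (hc : (p : ℤ) ∣ (c : ℤ) - 1) :
    (c : ℂ) ^ 2 - (c : ℂ) * χ (c : ZMod m) ≠ 0 ∧
      ∃ s : ℕ, ¬ p ∣ s ∧ IsIntegral ℤ ((s : ℂ) * ((c : ℂ) ^ 2 - (c : ℂ) * χ (c : ZMod m))⁻¹) := by
  have hord0 : orderOf χ ≠ 0 := fun h ↦ hord (h ▸ dvd_zero p)
  have hpow : χ (c : ZMod m) ^ orderOf χ = 1 := by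
    simpa using pow_orderOf_apply_eq_one χ hord0 hcu.unit
  have h := exists_isIntegral_mul_inv_katoFactor (c := (c : ℤ)) hord hpow hχc hc
  simpa using h

/-- Kato's factor with `μ = χ⁻¹(c) = χ̄(c)`: same hypotheses, `c² − c·χ⁻¹(c) ≠ 0` with `p`-integral
inverse. [cite: Kato2004Asterisque, Thm. 6.6 (1) p. 163] -/
theorem exists_isIntegral_mul_inv_katoFactor_dirichlet_inv {m : ℕ} (χ : DirichletCharacter ℂ m)
    (hord : ¬ p ∣ orderOf χ) {c : ℕ} (hcu : IsUnit (c : ZMod m)) (hχc : χ (c : ZMod m) ≠ 1)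
    (hc : (p : ℤ) ∣ (c : ℤ) - 1) :
    (c : ℂ) ^ 2 - (c : ℂ) * χ⁻¹ (c : ZMod m) ≠ 0 ∧
      ∃ s : ℕ, ¬ p ∣ s ∧ IsIntegral ℤ ((s : ℂ) * ((c : ℂ) ^ 2 - (c : ℂ) * χ⁻¹ (c : ZMod m))⁻¹) := by
  have hord0 : orderOf χ ≠ 0 := fun h ↦ hord (h ▸ dvd_zero p)
  obtain ⟨hpow, hne⟩ := inv_pow_orderOf_apply_eq_one χ hord0 hcu.unit
  have hpow' : χ⁻¹ (c : ZMod m) ^ orderOf χ = 1 := by simpa using hpow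
  have hne' : χ⁻¹ (c : ZMod m) ≠ 1 := by simpa using hne.2 (by simpa using hχc)
  have h := exists_isIntegral_mul_inv_katoFactor (c := (c : ℤ)) hord hpow' hne' hc
  simpa using h

/-! ## §5 The CRT choice of `c` (and `d`): `c ≡ 1 (mod M)`, `gcd(c, 6mM) = 1`, `χ(c) ≠ 1` -/

/-- CRT plumbing: for `K ≠ 0` and `x` prime to `K` there is `y > 1` with `y ≡ x (mod K)` and
`gcd(y, 6K) = 1` (adjust `x` modulo the part of `6` prime to `K`). [folklore] -/
theorem exists_modEq_coprime_six_mul {K x : ℕ} (hK : K ≠ 0) (hx : x.Coprime K) :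
    ∃ y : ℕ, 1 < y ∧ y ≡ x [MOD K] ∧ y.Coprime (6 * K) := by
  -- the auxiliary modulus `e ∣ 6`, prime to `K`, with `2 ∣ K·e` and `3 ∣ K·e`
  obtain ⟨e, he0, heK, h2, h3⟩ : ∃ e : ℕ, e ≠ 0 ∧ K.Coprime e ∧ (2 ∣ K ∨ 2 ∣ e) ∧ (3 ∣ K ∨ 3 ∣ e) := by
    by_cases hK2 : 2 ∣ K <;> by_cases hK3 : 3 ∣ K
    · exact ⟨1, one_ne_zero, Nat.coprime_one_right K, Or.inl hK2, Or.inl hK3⟩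
    · exact ⟨3, by norm_num, (Nat.Prime.coprime_iff_not_dvd Nat.prime_three).2 hK3 |>.symm,
        Or.inl hK2, Or.inr (dvd_refl 3)⟩
    · exact ⟨2, by norm_num, (Nat.Prime.coprime_iff_not_dvd Nat.prime_two).2 hK2 |>.symm,
        Or.inr (dvd_refl 2), Or.inl hK3⟩
    · refine ⟨6, by norm_num, ?_, Or.inr ⟨3, rfl⟩, Or.inr ⟨2, rfl⟩⟩
      have h2' := (Nat.Prime.coprime_iff_not_dvd Nat.prime_two).2 hK2
      have h3' := (Nat.Prime.coprime_iff_not_dvd Nat.prime_three).2 hK3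
      simpa using (Nat.Coprime.mul_left h2' h3').symm
  obtain ⟨y₀, hy₀K, hy₀e⟩ := Nat.chineseRemainder heK x 1
  -- `y₀ ≡ x [MOD K]`, `y₀ ≡ 1 [MOD e]`; shift by `2Ke` to get `y > 1`
  have hyK : y₀ + 2 * (K * e) ≡ x [MOD K] := by
    have h0 : 2 * (K * e) ≡ 0 [MOD K] := Nat.modEq_zero_iff_dvd.2 ⟨2 * e, by ring⟩
    simpa using hy₀K.add h0
  have hye : y₀ + 2 * (K * e) ≡ 1 [MOD e] := by
    have h0 : 2 * (K * e) ≡ 0 [MOD e] := Nat.modEq_zero_iff_dvd.2 ⟨2 * K, by ring⟩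
    simpa using hy₀e.add h0
  have hcopK : (y₀ + 2 * (K * e)).Coprime K := by
    rw [Nat.Coprime, hyK.gcd_eq]
    exact hx
  have hcope : (y₀ + 2 * (K * e)).Coprime e := by
    rw [Nat.Coprime, hye.gcd_eq]
    exact Nat.gcd_one_left e
  have hcop2 : (y₀ + 2 * (K * e)).Coprime 2 := by
    rcases h2 with h | h
    · exact Nat.Coprime.coprime_dvd_right h hcopK
    · exact Nat.Coprime.coprime_dvd_right h hcope
  have hcop3 : (y₀ + 2 * (K * e)).Coprime 3 := by
    rcases h3 with h | h
    · exact Nat.Coprime.coprime_dvd_right h hcopK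
    · exact Nat.Coprime.coprime_dvd_right h hcope
  refine ⟨y₀ + 2 * (K * e), ?_, hyK, ?_⟩
  · have h1 : 1 ≤ K * e := Nat.one_le_iff_ne_zero.2 (mul_ne_zero hK he0)
    omega
  · have h6 : (y₀ + 2 * (K * e)).Coprime (2 * 3) := Nat.Coprime.mul_right hcop2 hcop3
    exact Nat.Coprime.mul_right h6 hcopK

/-- ★ **The unit choice (CRT).** For a Dirichlet character `χ ≠ 1` mod `m` and a modulus `M ≠ 0` prime
to `m` there is a natural number `c > 1` with `c ≡ 1 (mod M)`, `gcd(c, 6mM) = 1`, `c` a unit mod `m` and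
`χ(c) ≠ 1`. With `M = pN` these are Kato's side conditions `(c, 6pmN) = 1` ((8.1.2) p. 180: `prime(c) ∩ S = ∅`,
`S = prime(mpN)`, `(c, 6) = 1`; Ex. 13.3 p. 225) and `c ≡ 1 mod N` (Thm. 6.6 (1), case `ξ ∈ SL₂(ℤ)`), plus
`c ≡ 1 (mod p)` and `χ(c) ≠ 1`, which make `c² − cχ^{±1}(c)` a `p`-unit (§3). F″ docstring item 4: "Choose
`c ≡ d ≡ 1 (mod pN)`, `(cd, 6) = 1`, with `χ(c)`, `χ(d)` [non-trivial] (CRT; `(m, 6pN)`-parts independent)";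
here `m` may be even or divisible by `3` (only `gcd(m, M) = 1` is used). [folklore] -/
theorem exists_unitChoice {m : ℕ} [NeZero m] (χ : DirichletCharacter ℂ m) (hχ : χ ≠ 1) {M : ℕ}
    (hM : M ≠ 0) (hmM : m.Coprime M) :
    ∃ c : ℕ, 1 < c ∧ c ≡ 1 [MOD M] ∧ c.Coprime (6 * (m * M)) ∧ IsUnit (c : ZMod m) ∧
      χ (c : ZMod m) ≠ 1 := by
  obtain ⟨u, hu⟩ := MulChar.ne_one_iff.1 hχ
  -- a natural representative `a` of the unit `u`
  have ha : (((u : ZMod m).val : ℕ) : ZMod m) = (u : ZMod m) := ZMod.natCast_zmod_val _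
  have hacop : ((u : ZMod m).val).Coprime m :=
    (ZMod.isUnit_iff_coprime _ m).1 (by rw [ha]; exact u.isUnit)
  obtain ⟨x₀, hx₀m, hx₀M⟩ := Nat.chineseRemainder hmM (u : ZMod m).val 1
  -- `x₀ ≡ a [MOD m]`, `x₀ ≡ 1 [MOD M]`
  have hx₀cop : (x₀ : ℕ).Coprime (m * M) := by
    refine Nat.Coprime.mul_right ?_ ?_
    · rw [Nat.Coprime, hx₀m.gcd_eq]
      exact hacop
    · rw [Nat.Coprime, hx₀M.gcd_eq]
      exact Nat.gcd_one_left M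
  obtain ⟨c, hc1, hcx, hccop⟩ :=
    exists_modEq_coprime_six_mul (mul_ne_zero (NeZero.ne m) hM) hx₀cop
  have hcm : c ≡ (u : ZMod m).val [MOD m] := (hcx.of_mul_right M).trans hx₀m
  have hcM : c ≡ 1 [MOD M] := (hcx.of_mul_left m).trans hx₀M
  have hcz : (c : ZMod m) = (u : ZMod m) := by
    rw [← ha]
    exact (ZMod.natCast_eq_natCast_iff _ _ _).2 hcm
  exact ⟨c, hc1, hcM, hccop, by rw [hcz]; exact u.isUnit, by rw [hcz]; exact hu⟩

/-- ★ **The unit choice in F″'s binders.** For `p` prime, `N, m ≥ 1` with `gcd(m, pN) = 1`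
(F″'s `m.Coprime (p * N)`), and a Dirichlet character `χ ≠ 1` mod `m` with `p ∤ ord χ` (F″'s binders):
there is `c ∈ ℕ`, `c > 1`, with `c ≡ 1 (mod N)`, `c ≡ 1 (mod p)` (also as `p ∣ c − 1` in `ℤ`),
`gcd(c, 6·m·p·N) = 1`, `c` a unit mod `m`, `χ(c) ≠ 1`, and BOTH Kato factors `c² − c·χ(c)`,
`c² − c·χ⁻¹(c)` non-zero with `p`-integral inverse. Taking `d := c` (or a second call) gives Kato's
`T = (c² − c^u χ(c))(d² − d^v χ̄(d))`, `(u, v) = (1, 1)`, as a `p`-unit (§3 `exists_isIntegral_mul_inv_katoT`,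
§1 `exists_isIntegral_mul`). [cite: Kato2004Asterisque, Thm. 6.6 (1) p. 163, (8.1.2) p. 180, Ex. 13.3 p. 225] -/
theorem exists_unitChoice_kato {N m : ℕ} [NeZero N] [NeZero m] (hm : m.Coprime (p * N))
    (χ : DirichletCharacter ℂ m) (hχ : χ ≠ 1) (hord : ¬ p ∣ orderOf χ) :
    ∃ c : ℕ, 1 < c ∧ c ≡ 1 [MOD N] ∧ c ≡ 1 [MOD p] ∧ (p : ℤ) ∣ (c : ℤ) - 1 ∧
      c.Coprime (6 * (m * (p * N))) ∧ IsUnit (c : ZMod m) ∧ χ (c : ZMod m) ≠ 1 ∧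
      ((c : ℂ) ^ 2 - (c : ℂ) * χ (c : ZMod m) ≠ 0 ∧
        ∃ s : ℕ, ¬ p ∣ s ∧ IsIntegral ℤ ((s : ℂ) * ((c : ℂ) ^ 2 - (c : ℂ) * χ (c : ZMod m))⁻¹)) ∧
      ((c : ℂ) ^ 2 - (c : ℂ) * χ⁻¹ (c : ZMod m) ≠ 0 ∧
        ∃ s : ℕ, ¬ p ∣ s ∧ IsIntegral ℤ ((s : ℂ) * ((c : ℂ) ^ 2 - (c : ℂ) * χ⁻¹ (c : ZMod m))⁻¹)) := by
  have hp : p.Prime := Fact.out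
  have hpN : p * N ≠ 0 := mul_ne_zero hp.ne_zero (NeZero.ne N)
  obtain ⟨c, hc1, hcM, hccop, hcu, hχc⟩ := exists_unitChoice χ hχ hpN hm
  have hcN : c ≡ 1 [MOD N] := hcM.of_mul_left p
  have hcp : c ≡ 1 [MOD p] := hcM.of_mul_right N
  have hcp' : (p : ℤ) ∣ (c : ℤ) - 1 := by
    simpa using Nat.modEq_iff_dvd.1 hcp.symm
  exact ⟨c, hc1, hcN, hcp, hcp', hccop, hcu, hχc,
    exists_isIntegral_mul_inv_katoFactor_dirichlet χ hord hcu hχc hcp',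
    exists_isIntegral_mul_inv_katoFactor_dirichlet_inv χ hord hcu hχc hcp'⟩

/-! ## §6 The socket `[divide T·u·n_ξ]` of the F″ programme -/

/-- ★ **`[divide T·u·n_ξ]`.** If `y` is `p`-integral (the output of the semi-local descent:
`y = Σ_b χ(b) σ_b(exp*_ω z)` with every component in `𝒪_w`) and the value law reads `y = T · w · L`
with `T ≠ 0` of `p`-integral inverse (Kato's `(c² − c^uχ(c))(d² − d^vχ̄(d))` for the unit choice of §5),
`w ∈ ℚ` with `p ∤ num w` (the real-structure factor `u ∈ {1, 2, ½}` times the Manin-symbol coordinate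
`n_ξ ∈ {±½, ±1}`, `p` odd), then `L` (`= L_S(f, χ, 1)/Ω^±`) is `p`-integral — the input of the value
exit. [folklore] -/
theorem exists_isIntegral_of_valueLaw {T L y : ℂ} {w : ℚ} (hT : T ≠ 0)
    (hTinv : ∃ s : ℕ, ¬ p ∣ s ∧ IsIntegral ℤ ((s : ℂ) * T⁻¹)) (hw : ¬ (p : ℤ) ∣ w.num)
    (hlaw : y = T * (w : ℂ) * L) (hy : ∃ s : ℕ, ¬ p ∣ s ∧ IsIntegral ℤ ((s : ℂ) * y)) :
    ∃ s : ℕ, ¬ p ∣ s ∧ IsIntegral ℤ ((s : ℂ) * L) := by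
  have hw0 : (w : ℂ) ≠ 0 := by
    have hw0' : w ≠ 0 := by
      rintro rfl
      exact hw (by simp)
    exact_mod_cast hw0'
  rw [hlaw, mul_assoc] at hy
  exact exists_isIntegral_of_mul_left hw0 (exists_isIntegral_of_mul_left hT hy hTinv)
    (exists_isIntegral_mul_inv_ratCast hw)

/-- ★ **`[divide T·u·n_ξ]` with the unit choice made.** In F″'s binders (`gcd(m, pN) = 1`, `χ ≠ 1`
primitive or not, `p ∤ ord χ`) there are `c, d ∈ ℕ` (here `d = c`), `> 1`, `≡ 1 (mod N)` and `(mod p)`,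
prime to `6mpN`, units mod `m`, such that for Kato's `SL₂(ℤ)`-type factor
`T = (c² − c·χ⁻¹(c))(d² − d·χ⁻¹(d))` and EVERY value law `y = T · w · L` (`w ∈ ℚ`, `p ∤ num w`) with `y`
`p`-integral, `L` is `p`-integral. [cite: Kato2004Asterisque, Thm. 6.6 (1) p. 163] -/
theorem exists_unitChoice_divide {N m : ℕ} [NeZero N] [NeZero m] (hm : m.Coprime (p * N))
    (χ : DirichletCharacter ℂ m) (hχ : χ ≠ 1) (hord : ¬ p ∣ orderOf χ) :
    ∃ c d : ℕ, 1 < c ∧ 1 < d ∧ c ≡ 1 [MOD N] ∧ d ≡ 1 [MOD N] ∧ c ≡ 1 [MOD p] ∧ d ≡ 1 [MOD p] ∧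
      c.Coprime (6 * (m * (p * N))) ∧ d.Coprime (6 * (m * (p * N))) ∧
      IsUnit (c : ZMod m) ∧ IsUnit (d : ZMod m) ∧
      ((c : ℂ) ^ 2 - (c : ℂ) * χ⁻¹ (c : ZMod m)) * ((d : ℂ) ^ 2 - (d : ℂ) * χ⁻¹ (d : ZMod m)) ≠ 0 ∧
      ∀ (w : ℚ) (L y : ℂ), ¬ (p : ℤ) ∣ w.num →
        y = ((c : ℂ) ^ 2 - (c : ℂ) * χ⁻¹ (c : ZMod m)) * ((d : ℂ) ^ 2 - (d : ℂ) * χ⁻¹ (d : ZMod m)) *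
          (w : ℂ) * L →
        (∃ s : ℕ, ¬ p ∣ s ∧ IsIntegral ℤ ((s : ℂ) * y)) →
        ∃ s : ℕ, ¬ p ∣ s ∧ IsIntegral ℤ ((s : ℂ) * L) := by
  obtain ⟨c, hc1, hcN, hcp, -, hccop, hcu, -, -, hT0, hTinv⟩ := exists_unitChoice_kato hm χ hχ hord
  refine ⟨c, c, hc1, hc1, hcN, hcN, hcp, hcp, hccop, hccop, hcu, hcu, mul_ne_zero hT0 hT0, ?_⟩
  intro w L y hw hlaw hy
  have hTT : ∃ s : ℕ, ¬ p ∣ s ∧ IsIntegral ℤ ((s : ℂ) *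
      (((c : ℂ) ^ 2 - (c : ℂ) * χ⁻¹ (c : ZMod m)) * ((c : ℂ) ^ 2 - (c : ℂ) * χ⁻¹ (c : ZMod m)))⁻¹) := by
    rw [mul_inv]
    exact exists_isIntegral_mul hTinv hTinv
  exact exists_isIntegral_of_valueLaw (mul_ne_zero hT0 hT0) hTT hw hlaw hy

end Summit.BirchSwinnertonDyer.BirchSwinnertonDyer.Theorems.KatoUnitChoice

end
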